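import Mathlib
import HarnessLib
import Summits.HubbardSuperconductivity.HubbardSuperconductivity.Theorems.KLProgrammeKLRegimeSplitFlowPieceMeanOsc

/-!
# Route `KLProgramme`, crux K3 — gen-8 ENGINE-FLOW child (stmt-HubbardSuperconductivity-20437 `KLRegimeEngineV17F2`), v2 token #19, plan g19 ruling
# **(R59ax) (K5′) «MEAN-FREE SPLIT»**: the two TEXTS OF RECORD — the mean-free k = 0 clause of the READING `TwoLegReadOscAt` (added to stub (C)'s
# conclusion at T) and of the FLOW PIECE `FlowPieceOscAt` (added to stub (b)'s history at T) — and the text-neutral bridge between them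
# (cell gate-hubbard-kl, seat hubbard-kl-r2d-p1 g9; evidence #55 `K5-ANSWER-r2dp1-g9.md` on 20437; pen KL STATUS 2026-08-27 l.3677)

WHY (one paragraph).  The (c-D) telescoping of the (b) tower (k3c3-p2 CD-LIMITS §1, E1 WORD10 (W3)) is U-uniform iff the telescoped flow pieces `m ≥ m₀(j)` are
booked in `U²` currency at order 0 with the `16^{−m}` value law; the registered `FlowPieceJetsAt` books `|U|` because the piece contains the scale-`m` tadpole.
`…SplitFlowPieceMeanOsc` (this seat, p567287) proves the piece is EXACTLY its angular mean (the first-order, θ-constant tadpole / δμ part — an exact level shift,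
zero excess in the tower) plus the Jackson mean of its mean-free part, and that the sup of the latter is inherited from the reading with the SAME constant.  So
the one datum the tower needs is the mean-free value clause, at the reading level (where stub (C)'s lane produces order 0) and at the piece level (where (b)
reads it):

* `TwoLegReadOscAt L M c″ β U μ K n` := `∀ θ, |ν_n(K)(θ) − klAngularMean ν_n(K)| ≤ c″·U²·4^{−2n}` (`ν_n(K) = klLocalPart … K n`; pen's text verbatim);
* `FlowPieceOscAt L M c″ β U μ m` := `∀ q, |evalM (klFlowPiece … m) q − klAngularMean ν_m(K_m)| ≤ c″·U²·4^{−2m}` — the pen's text with the constant slot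
  DEDICATED (my call per (R59ax) «else a dedicated constant, your call»): the bridge preserves the constant exactly, so the piece datum carries the READING's
  `c″` and the §C composition needs no fit against an `R.Gfr 5` slot (in 20437's §C `R` is a ∀-binder known only through `R.WF2`); the tower needs only an
  `m`-free `U²`-currency constant;
* `flowPieceOscAt_of_readOscAt` — THE BRIDGE: `TwoLegReadOscAt L M c″ β U μ (K_m) m` ∧ `ν_m ∈ C⁴` (e.g. from `TwoLegReadJetBound`/`TwoLegReadJetsF`) ∧
  `μ ∈ klWindowC` ⟹ `FlowPieceOscAt L M c″ β U μ m`; `flowPieceOscAt_hist_of_readOscAt` — the (b)-history shape `∀ m, 1 ≤ m → m < n → FlowPieceOscAt … m` from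
  the reading clauses at `m < n`; monotonicity in `c″`; unfolding lemmas; the `16^{−m}` reading of the exponent;
* §4 the PRODUCER door for stub (C)'s lane: a reading within `c″/2·U²·4^{−2n}` of ANY constant (its θ-constant first-order tadpole value, say) satisfies
  `TwoLegReadOscAt … c″ …` (`twoLegReadOscAt_of_abs_sub_const_le`) — the producer never computes the mean.

Definitions + bookkeeping only; nothing about the Hubbard model is asserted (no stub of 20437 is claimed; whether stub (C)'s lane can supply `TwoLegReadOscAt` at
`c₀″·U²·16^{−n}` is its (Q-C) word); nothing here asserts K3 or superconductivity.  References: BGM 2006 §2.4 (2.36) [cite: BenfattoGiulianiMastropietro2006]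
(the `C₀|U|` value law: the tadpole is first order and momentum-independent; `C_j U²`, `j ≥ 1`).
-/

noncomputable section

namespace Summit.HubbardSuperconductivity.HubbardSuperconductivity.Theorems.KLRegimeSplit

set_option linter.dupNamespace false -- summit = problem name (single-conjunct summit), D-0017

open Real Literature.MathematicalPhysics.QuantumLattice Literature.Probability.LatticeModels
open Literature.MathematicalPhysics.QuantumLattice.FermiRG

/-! ## §1 The two texts of record -/

section Defs

variable (L M : ℕ) [NeZero L] [NeZero M]

/-- **`TwoLegReadOscAt L M c″ β U μ K n`** — the MEAN-FREE value clause of the scale-`n` cumulative reading on the frame `K` ((R59ax), reading level; the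
conjunct stub (C)'s conclusion gains at T, `K := K_n`): `|ν_n(K)(θ) − klAngularMean ν_n(K)| ≤ c″·U²·4^{−2n}` at every angle — `U²` currency (the first-order
tadpole is θ-constant and drops exactly), `16^{−n}` value law. -/
def TwoLegReadOscAt (c'' β U μ : ℝ) (K : TrigPolyC4v) (n : ℕ) : Prop :=
  ∀ θ : ℝ, |klLocalPart L M β U μ K n θ - klAngularMean (klLocalPart L M β U μ K n)| ≤ c'' * U ^ 2 * (4 : ℝ) ^ (-2 * (n : ℤ))

/-- **`FlowPieceOscAt L M c″ β U μ m`** — the MEAN-FREE value clause of the scale-`m` FLOW PIECE ((R59ax), piece level; the conjunct stub (b)'s history gains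
at T as `∀ m, 1 ≤ m → m < n → FlowPieceOscAt … m`): `|evalM (klFlowPiece m) q − klAngularMean ν_m(K_m)| ≤ c″·U²·4^{−2m}` at every continuum momentum `q`.
The constant slot is the READING's `c″` (dedicated slot, not `R.Gfr 5`: the bridge below preserves it exactly). -/
def FlowPieceOscAt (c'' β U μ : ℝ) (m : ℕ) : Prop :=
  ∀ q : Momentum, |evalM (klFlowPiece L M β U μ m) q -
      klAngularMean (klLocalPart L M β U μ (klFlowFrameU L M β U μ m) m)| ≤ c'' * U ^ 2 * (4 : ℝ) ^ (-2 * (m : ℤ))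

end Defs

/-! ## §2 Bookkeeping: unfolding, the exponent, monotonicity -/

section Book

variable {L M : ℕ} [NeZero L] [NeZero M]

/-- Unfolding `TwoLegReadOscAt`. -/
theorem twoLegReadOscAt_iff (c'' β U μ : ℝ) (K : TrigPolyC4v) (n : ℕ) :
    TwoLegReadOscAt L M c'' β U μ K n ↔
      ∀ θ : ℝ, |klLocalPart L M β U μ K n θ - klAngularMean (klLocalPart L M β U μ K n)| ≤ c'' * U ^ 2 * (4 : ℝ) ^ (-2 * (n : ℤ)) :=
  Iff.rfl

/-- Unfolding `FlowPieceOscAt`. -/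
theorem flowPieceOscAt_iff (c'' β U μ : ℝ) (m : ℕ) :
    FlowPieceOscAt L M c'' β U μ m ↔
      ∀ q : Momentum, |evalM (klFlowPiece L M β U μ m) q -
        klAngularMean (klLocalPart L M β U μ (klFlowFrameU L M β U μ m) m)| ≤ c'' * U ^ 2 * (4 : ℝ) ^ (-2 * (m : ℤ)) :=
  Iff.rfl

omit [NeZero L] [NeZero M] in
/-- The exponent: `4^{−2m} = (16^m)⁻¹`. -/
theorem four_zpow_neg_two_mul (m : ℕ) : (4 : ℝ) ^ (-2 * (m : ℤ)) = ((16 : ℝ) ^ m)⁻¹ := by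
  rw [show (-2 : ℤ) * (m : ℤ) = -((2 * m : ℕ) : ℤ) by push_cast; ring, zpow_neg, zpow_natCast, pow_mul]
  norm_num

omit [NeZero L] [NeZero M] in
/-- The exponent agrees with `FlowPieceJetsAt`'s at `j = 0`: `4^{((0:ℤ) − 2)·m} = 4^{−2m}`. -/
theorem four_zpow_ord_zero_eq (m : ℕ) : (4 : ℝ) ^ ((((0 : ℕ) : ℤ) - 2) * (m : ℤ)) = (4 : ℝ) ^ (-2 * (m : ℤ)) := by
  norm_num

/-- Monotonicity of the reading clause in the constant. -/
theorem TwoLegReadOscAt.mono {c'' d'' β U μ : ℝ} {K : TrigPolyC4v} {n : ℕ} (h : TwoLegReadOscAt L M c'' β U μ K n) (hcd : c'' ≤ d'') :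
    TwoLegReadOscAt L M d'' β U μ K n := fun θ =>
  (h θ).trans (mul_le_mul_of_nonneg_right (mul_le_mul_of_nonneg_right hcd (sq_nonneg U)) (zpow_nonneg (by norm_num) _))

/-- Monotonicity of the piece clause in the constant. -/
theorem FlowPieceOscAt.mono {c'' d'' β U μ : ℝ} {m : ℕ} (h : FlowPieceOscAt L M c'' β U μ m) (hcd : c'' ≤ d'') :
    FlowPieceOscAt L M d'' β U μ m := fun q =>
  (h q).trans (mul_le_mul_of_nonneg_right (mul_le_mul_of_nonneg_right hcd (sq_nonneg U)) (zpow_nonneg (by norm_num) _))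

/-- The reading clause forces `0 ≤ c″·U²·4^{−2n}` (hence `0 ≤ c″` when `U ≠ 0`). -/
theorem TwoLegReadOscAt.bound_nonneg {c'' β U μ : ℝ} {K : TrigPolyC4v} {n : ℕ} (h : TwoLegReadOscAt L M c'' β U μ K n) :
    0 ≤ c'' * U ^ 2 * (4 : ℝ) ^ (-2 * (n : ℤ)) :=
  (abs_nonneg _).trans (h 0)

/-- The piece clause in the `(16^m)⁻¹` law. -/
theorem FlowPieceOscAt.le_sixteen {c'' β U μ : ℝ} {m : ℕ} (h : FlowPieceOscAt L M c'' β U μ m) (q : Momentum) :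
    |evalM (klFlowPiece L M β U μ m) q - klAngularMean (klLocalPart L M β U μ (klFlowFrameU L M β U μ m) m)| ≤
      c'' * U ^ 2 * ((16 : ℝ) ^ m)⁻¹ := by
  rw [← four_zpow_neg_two_mul]; exact h q

end Book

/-! ## §3 The bridge: reading clause ⇒ piece clause, same constant; the (b)-history shape -/

section Bridge

variable {L M : ℕ} [NeZero L] [NeZero M]

/-- **THE BRIDGE (R59ax)**: the mean-free value clause of the scale-`m` reading on the flow frame `K_m`, the reading `C⁴`, `μ ∈ klWindowC` ⟹ the mean-free value
clause of the scale-`m` flow piece with the SAME constant (`abs_evalM_klFlowPiece_sub_mean_le`: the flat cutoff is in `[0,1]`, the Jackson mean is a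
positivity-preserving mean reproducing constants). -/
theorem flowPieceOscAt_of_readOscAt {c'' β U μ : ℝ} (hμ : μ ∈ klWindowC) {m : ℕ}
    (hf : ContDiff ℝ 4 fun θ : ℝ => klLocalPart L M β U μ (klFlowFrameU L M β U μ m) m θ)
    (h : TwoLegReadOscAt L M c'' β U μ (klFlowFrameU L M β U μ m) m) : FlowPieceOscAt L M c'' β U μ m := fun q =>
  abs_evalM_klFlowPiece_sub_mean_le hμ hf h q

/-- The bridge with the smoothness read from the reading-jet predicate `TwoLegReadJetBound … (K_m) m` (stub (C)'s conclusion currency). -/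
theorem flowPieceOscAt_of_readOscAt_of_readJetBound {c'' β U μ : ℝ} (hμ : μ ∈ klWindowC) {m : ℕ} {c c' : ℕ → ℝ}
    (hJ : TwoLegReadJetBound L M c c' β U μ (klFlowFrameU L M β U μ m) m)
    (h : TwoLegReadOscAt L M c'' β U μ (klFlowFrameU L M β U μ m) m) : FlowPieceOscAt L M c'' β U μ m :=
  flowPieceOscAt_of_readOscAt hμ hJ.1 h

/-- The bridge with the smoothness read from `TwoLegReadJetsF … m` (the registered two-leg slot's first conjunct). -/
theorem flowPieceOscAt_of_readOscAt_of_readJetsF {c'' β U μ : ℝ} (hμ : μ ∈ klWindowC) {m : ℕ} {G : GeoConsts} {Q : EngConsts}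
    (hJ : TwoLegReadJetsF L M G Q β U μ m) (h : TwoLegReadOscAt L M c'' β U μ (klFlowFrameU L M β U μ m) m) :
    FlowPieceOscAt L M c'' β U μ m :=
  flowPieceOscAt_of_readOscAt hμ hJ.1 h

/-- **The (b)-HISTORY SHAPE from the reading clauses below `n`**: if at every `1 ≤ m < n` the scale-`m` reading on `K_m` is `C⁴` and satisfies the mean-free
clause, then `∀ m, 1 ≤ m → m < n → FlowPieceOscAt L M c″ β U μ m` — the conjunct stub (b)'s history gains at T, composed in §C from stub (C)'s conclusions at
the lower scales. -/
theorem flowPieceOscAt_hist_of_readOscAt {c'' β U μ : ℝ} (hμ : μ ∈ klWindowC) {n : ℕ}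
    (hf : ∀ m, 1 ≤ m → m < n → ContDiff ℝ 4 fun θ : ℝ => klLocalPart L M β U μ (klFlowFrameU L M β U μ m) m θ)
    (h : ∀ m, 1 ≤ m → m < n → TwoLegReadOscAt L M c'' β U μ (klFlowFrameU L M β U μ m) m) :
    ∀ m, 1 ≤ m → m < n → FlowPieceOscAt L M c'' β U μ m := fun m h1 hm =>
  flowPieceOscAt_of_readOscAt hμ (hf m h1 hm) (h m h1 hm)

/-- The (b)-history shape with the smoothness read from the registered history `HistP klPredsV17F2 … n` (its `TwoLegReadJetsF` at every `m < n`). -/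
theorem flowPieceOscAt_hist_of_readOscAt_of_histP {c'' β U μ : ℝ} (hμ : μ ∈ klWindowC) {G : GeoConsts} {P : SplitConsts} {Q : EngConsts}
    {R : RenConsts} {K : TrigPolyC4v} {n : ℕ} (hh : HistP klPredsV17F2 L M G P Q R β U μ K n)
    (h : ∀ m, 1 ≤ m → m < n → TwoLegReadOscAt L M c'' β U μ (klFlowFrameU L M β U μ m) m) :
    ∀ m, 1 ≤ m → m < n → FlowPieceOscAt L M c'' β U μ m := fun m h1 hm =>
  flowPieceOscAt_of_readOscAt_of_readJetsF hμ ((histP_klPredsV17F2_iff L M G P Q R β U μ K n).1 hh m hm).2.2.2.1 (h m h1 hm)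

/-- **What the registered history ALONE gives, in this currency, is the `4^{−m}` law, not `FlowPieceOscAt`**: from `HistP` the scale-`m` piece is within
`2π(S₁ + S₁′|U|)·U²·4^{−m}` of its mean (`abs_evalM_klFlowPiece_sub_mean_le_of_histP`) — recorded here as the reason the clause is an ADDED datum ((R59ax)(i):
(a) = NO). -/
theorem abs_evalM_klFlowPiece_sub_mean_le_four_pow_of_histP {β U μ : ℝ} (hμ : μ ∈ klWindowC) {G : GeoConsts} {P : SplitConsts} {Q : EngConsts}
    {R : RenConsts} {K : TrigPolyC4v} {n : ℕ} (hh : HistP klPredsV17F2 L M G P Q R β U μ K n) {m : ℕ} (hm : m < n) (q : Momentum) :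
    |evalM (klFlowPiece L M β U μ m) q - klAngularMean (klLocalPart L M β U μ (klFlowFrameU L M β U μ m) m)| ≤
      2 * π * ((G.S 1 + Q.S' 1 * |U|) * U ^ 2 * ((4 : ℝ) ^ m)⁻¹) :=
  abs_evalM_klFlowPiece_sub_mean_le_of_histP hμ hh hm q

end Bridge


/-! ## §4 Producer-side door: within `B` of ANY constant ⇒ within `2B` of the mean -/

section Producer

variable {L M : ℕ} [NeZero L] [NeZero M]

omit [NeZero L] [NeZero M] in
/-- **Within `B` of a constant ⇒ within `2B` of the angular mean** (interval-integrable profile): if `|f θ − τ| ≤ B` for all `θ` and SOME constant `τ` (for the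
two-leg reading: its first-order, θ-constant tadpole value plus any constant part of the higher orders), then `|f θ − klAngularMean f| ≤ 2B` — the producer of
`TwoLegReadOscAt` never has to compute the mean. -/
theorem abs_sub_klAngularMean_le_two_mul_of_abs_sub_const_le {f : ℝ → ℝ} (hf : IntervalIntegrable f MeasureTheory.volume 0 (2 * π))
    {τ B : ℝ} (h : ∀ θ, |f θ - τ| ≤ B) (θ : ℝ) : |f θ - klAngularMean f| ≤ 2 * B := by
  have hmean : |klAngularMean f - τ| ≤ B := by
    rw [← klAngularMean_sub_const hf τ]
    exact abs_klAngularMean_le' h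
  calc |f θ - klAngularMean f| = |(f θ - τ) - (klAngularMean f - τ)| := by ring_nf
    _ ≤ |f θ - τ| + |klAngularMean f - τ| := abs_sub _ _
    _ ≤ B + B := add_le_add (h θ) hmean
    _ = 2 * B := by ring

/-- **PRODUCER DOOR for `TwoLegReadOscAt`**: a `C⁴` (indeed continuous) reading within `c″/2·U²·4^{−2n}` of SOME constant satisfies the mean-free clause with
constant `c″`. -/
theorem twoLegReadOscAt_of_abs_sub_const_le {c'' β U μ : ℝ} {K : TrigPolyC4v} {n : ℕ}
    (hf : Continuous fun θ : ℝ => klLocalPart L M β U μ K n θ) (τ : ℝ)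
    (h : ∀ θ, |klLocalPart L M β U μ K n θ - τ| ≤ c'' / 2 * U ^ 2 * (4 : ℝ) ^ (-2 * (n : ℤ))) :
    TwoLegReadOscAt L M c'' β U μ K n := fun θ => by
  have h2 := abs_sub_klAngularMean_le_two_mul_of_abs_sub_const_le (hf.intervalIntegrable _ _) h θ
  calc |klLocalPart L M β U μ K n θ - klAngularMean (klLocalPart L M β U μ K n)| ≤ 2 * (c'' / 2 * U ^ 2 * (4 : ℝ) ^ (-2 * (n : ℤ))) := h2
    _ = c'' * U ^ 2 * (4 : ℝ) ^ (-2 * (n : ℤ)) := by ring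

/-- The producer door with the smoothness read from a reading-jet predicate `TwoLegReadJetBound … K n`. -/
theorem twoLegReadOscAt_of_abs_sub_const_le_of_readJetBound {c'' β U μ : ℝ} {K : TrigPolyC4v} {n : ℕ} {c c' : ℕ → ℝ}
    (hJ : TwoLegReadJetBound L M c c' β U μ K n) (τ : ℝ)
    (h : ∀ θ, |klLocalPart L M β U μ K n θ - τ| ≤ c'' / 2 * U ^ 2 * (4 : ℝ) ^ (-2 * (n : ℤ))) :
    TwoLegReadOscAt L M c'' β U μ K n :=
  twoLegReadOscAt_of_abs_sub_const_le hJ.1.continuous τ h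

end Producer

end Summit.HubbardSuperconductivity.HubbardSuperconductivity.Theorems.KLRegimeSplit

end
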